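import Literature.MathematicalPhysics.QuantumFieldTheory.Balaban1983to89.B9Thm311SmallFieldGreen
import Literature.MathematicalPhysics.QuantumFieldTheory.Balaban1983to89.B9Ineq369CurvatureOperatorBound

/-!
# `Balaban1983to89.B9Eq3126H1Bound` — T. Bałaban, *Propagators for lattice gauge theories in a background field*, Commun. Math. Phys. **99** (1985)
# 389–434 [Balaban1985BackgroundPropagators] (3.126) p. 420, (3.153) p. 426 with Thm 3.4 p. 400 / Thm 3.11 p. 416: THE pub-balaban NE9 CHAIN'S
# `H₁(U) = G₁Q†(QG₁Q†)⁻¹` AND `𝔊(U) = G₁𝔓*` ARE BOUNDED UNIFORMLY OVER THE SMALL FIELDS OF A FIXED LATTICE (crude `L²` operator norms) —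
# the letters of `B9Eq3126GreenLetters` at the chain's assembled `Δ_a(U)`, with the uniform coercivity of `B9Thm311SmallFieldGreen`, a uniform
# operator bound of `Δ_a(U)` (here), and the flat modulus of `Q(1)†` perturbed by NE9 leaf-04's `δ_Q`

statement-level skeleton of published theorems with citation tags; proofs where landed; nothing here is a claim about the Yang–Mills mass gap

PDF held: `paper:balaban1985-cmp99-background-propagators` (journal page = PDF page + 388), pp. 392–397, 400, 404, 416, 420, 426 read by this seat (2026-08-22).

THE PRINT (verbatim).  p. 420, (3.126): *«HB = GQ*(QGQ*)⁻¹B»*; p. 407, (3.86): *«G(U′U) = G(U)(I − V(A)G(U))⁻¹ … convergence is in the operator norm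
for α₁ sufficiently small … This way we get all these inequalities for the operator G(U′U)»*; p. 416, Thm 3.11.

WHY THIS FILE (cell context).  `Support/NE9CurChartOfBackground.cur_chart_exists_of_small_field` (owner gen 80, v1.3) gives the chart of the `cur U`
species at every small field, with radii from `B11Eq118RegimeRadii.exists_twoRegimes_radii (B₀ := ‖𝔊(U)‖, b := ‖H(U)‖, …)`; a species needs the
radii UNIFORM in `U`, hence uniform bounds of `𝔊(U)`, `H₁(U)`.  This file proves them on the `L²` carriers (`B11Eq103H1Complex.H1LatticeK`,
`frakGLatticeK`); the transfer to the chart's Banach norms (`NegSize`/`Space115`, finite-lattice norm equivalences) is the next junction.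

WHAT IS PROVED (sorry-free; no `Prop` placeholder; no inequality of the paper asserted as a hypothesis-free fact).
* **`norm_laplaceAofBackground_le`**: at a background with `‖U(b) − 1‖ ≤ ε`, `2M_φM_φ′ε ≤ 1`, `hRS` and `‖Q(U)x‖ ≤ M_{QU}‖x‖`:
  `‖Δ_a(U)x‖ ≤ (64d|η|⁻² + 16d|η|⁻² + 128d·C_τM_φ²(|η|^d/c₀)|η|⁻²ε + |a|M_{QU}²)‖x‖` (curl/cocurl, `D`/`D*`, curvature (`B9Ineq369CurvatureOperatorBound`),
  averaging).
* **`exists_H1_frakG_bound_of_small_field`**: `∃ C_H C_G ε₅ > 0` such that for every background `U` of E162's data with `‖U(b) − 1‖ ≤ ε ≤ ε₅`, `hRS`,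
  and ANY witnesses `hpos` (positivity of `Δ_a(U)`), `hQ` (`Q(U)` onto): `‖H1LatticeK hpos hQ b‖ ≤ C_H‖b‖`, `‖frakGLatticeK hpos hQ x‖ ≤ C_G‖x‖`.
MODEL / DECLARED READINGS.  (M1)/(M2) as `B9Thm311SmallFieldClosed` (displayed: `hRS`, `M_φ`, `M_φ′`, `C_τ`, `a > 0`, `η ≠ 0`); `δ_Q` by NE9 leaf-04's
`B9Eq315QLipschitz.norm_QtorusW_sub_flat_le`; the flat modulus `μ_{Q1}` of `Q(1)†` from `Q(1)` onto (`B9Eq315QTorusOnto.QtorusW_surjective` at the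
flat letters).  (M3) NOT HERE: the chart's Banach norms, decay, uniformity in the lattice, the gauge step.
HONEST SCOPE.  [folklore] finite-dimensional bookkeeping for the chain's OWN letters at a fixed lattice (`C_H`, `C_G`, `ε₅` depend on `L`, `m`, `η`,
`c₀`, `c₁`); NOT summit progress (cell pub-balaban: NE9 NOT PRINTED / NOT PROVED; spine PROVED 0/9).  Filed by the pub-balaban NE9 BINDER-row owner
lineage `b2b-balaban-t4-ne9-p1` (gen 80); NEW file importing `B9Thm311SmallFieldGreen` (hence `B9Eq3126GreenLetters`, `B9Thm311SmallFieldClosed`),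
`B9Ineq369CurvatureOperatorBound`; nothing modified.
Net new unproved facts: 0.
-/

noncomputable section

open scoped InnerProductSpace ComplexConjugate BigOperators

namespace Literature.MathematicalPhysics.QuantumFieldTheory.Balaban1983to89.B9Eq3126H1Bound

open B9Eq373DerivativeRemainderL2 (norm_adjoint_apply_le)
open B9Eq3126GreenLetters (norm_H1K_le norm_frakGLin_le exists_modulus_of_injective adjoint_injective_of_modulus)

/-! ## §3 At the NE9 chain's letters: `H₁(U)`, `𝔊(U)` are bounded UNIFORMLY over the small fields of a fixed lattice -/

section SmallField

open B4Sect5Torus (TSite)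
open B9SectCLatticeCarrier (Bond)
open B7Prop1Explicit (U1 Wcx boxVec)
open B9Eq311L2Pairing (WL2)
open B9Eq319QprimeTorus (fineP)
open B11Eq103H1Complex (SiteL2K BondL2K covDerivL2K covDivL2K laplaceALatticeK H1LatticeK frakGLatticeK G1LatticeK KinvLatticeK hadj_adjoint
  adjoint_injective_of_surjective)
open B9Eq310HessianOperator (adTransportW principalOpK hessOp hessOp_apply curvOp)
open B9Eq310DeltaPrime (plaqHolU)
open B9Eq326OperatorAssembly (RofU)
open B9Eq315QTorus (perCfg cornerSite QtorusW laplaceAofBackground)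
open B9Eq315QTorusOnto (liftSite perSite_liftSite QtorusW_surjective)
open B5Eq172FlatCoercivity (hU1_one hreg_one)
open B9Eq368ProjectionRemainder (norm_projR_le)
open B9Eq373DerivativeRemainderL2 (norm_covDerivL2K_le norm_covDivL2K_le norm_covCurlL2K_le norm_covCoCurlL2K_le)
open B9Eq384RemainderLetters (norm_adTransportW_sub_le)
open B9Eq315QLipschitz (norm_QtorusW_sub_flat_le)
open B9Thm311SmallFieldClosed (norm_plaqHolU_sub_one_le)
open B9Thm311SmallFieldGreen (exists_coercive_laplaceA_of_small_field)
open B9Ineq369CurvatureOperatorBound (norm_curvOp_le)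

variable {d : ℕ} (L : ℕ) [NeZero L] (m : Fin d → ℕ) [∀ i, NeZero (fineP L m i)] (hL : 1 ≤ L)
  {𝔸 : Type*} [NormedRing 𝔸] [NormedAlgebra ℂ 𝔸] [CompleteSpace 𝔸] [NormOneClass 𝔸] [StarRing 𝔸] [NormedStarGroup 𝔸] [StarModule ℂ 𝔸]
  {W : Type*} [NormedAddCommGroup W] [InnerProductSpace ℂ W] [FiniteDimensional ℂ W] (φ : W ≃ₗ[ℂ] 𝔸) {c₀ c₁ : ℝ} [Fact (0 < c₀)] [Fact (0 < c₁)]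

/-- **THE ASSEMBLED `Δ_a(U)` IS UNIFORMLY BOUNDED AT EVERY SMALL FIELD**: `‖Δ_a(U)x‖ ≤ M·‖x‖` with
`M = 64d|η|⁻² + 16d|η|⁻² + 128d·C_τM_φ²(|η|^d/c₀)|η|⁻²·ε + |a|·M_{QU}²` (`M_{QU}` any operator bound of `Q(U)`, e.g. `MQ + δ_Q`) from the curl/cocurl, `D`/`D*`, curvature
and averaging bounds (`εR ≤ 1`). [cite: Balaban1985BackgroundPropagators, (3.26) p.395, (3.10) p.392, (3.69) p.404] -/
theorem norm_laplaceAofBackground_le {Mφ Mφ' : ℝ} (hMφ : 0 ≤ Mφ) (hMφ' : 0 ≤ Mφ') (hφ : ∀ w, ‖φ w‖ ≤ Mφ * ‖w‖) (hφ' : ∀ X, ‖φ.symm X‖ ≤ Mφ' * ‖X‖)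
    (τ : 𝔸 →ₗ[ℂ] ℂ) {Cτ : ℝ} (hτ : ∀ X, ‖τ X‖ ≤ Cτ * ‖X‖) (hCτ : 0 ≤ Cτ) {η : ℝ} (a : ℝ)
    (U : Bond d (fineP L m) → 𝔸ˣ) {α : ℝ} (hα1 : α ≤ 1 / 64)
    (hU1 : ∀ (x : B7Prop1Explicit.Site d) (κ : Fin d), perCfg (fineP L m) U x κ ∈ U1 𝔸)
    (hreg : ∀ (y : TSite d m) (κ : Fin d) (r : Fin d → Fin L), ‖((Wcx L (perCfg (fineP L m) U) (cornerSite L y) κ (boxVec L r) : 𝔸ˣ) : 𝔸) - 1‖ ≤ α)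
    {ε : ℝ} (hε : 0 ≤ ε) (hεR1 : 2 * Mφ * Mφ' * ε ≤ 1) (hUε : ∀ b, ‖(U b : 𝔸) - 1‖ ≤ ε)
    (hRS : ∀ (b : Bond d (fineP L m)) (v u : W), ⟪adTransportW φ U b v, u⟫_ℂ = ⟪v, adTransportW φ (fun b => (U b)⁻¹) b u⟫_ℂ)
    {MQU : ℝ} (hMQU : 0 ≤ MQU) (hQU : ∀ x : BondL2K ℂ d (fineP L m) c₀ W, ‖QtorusW L m hL φ U hα1 hU1 hreg (c₁ := c₁) x‖ ≤ MQU * ‖x‖)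
    (x : BondL2K ℂ d (fineP L m) c₀ W) :
    ‖laplaceAofBackground L m hL φ U hα1 hU1 hreg τ η (c₀ := c₀) (c₁ := c₁) a x‖ ≤
      (64 * d * ‖((η : ℂ))⁻¹‖ ^ 2 + 16 * ‖((η : ℂ))⁻¹‖ ^ 2 * d + 32 * d * Cτ * Mφ ^ 2 * (|η| ^ d / c₀) * (‖((η : ℂ))⁻¹‖ ^ 2 * (4 * ε))
        + MQU * (|a| * MQU)) * ‖x‖ := by
  have hc : conj ((η : ℂ))⁻¹ = ((η : ℂ))⁻¹ := by rw [map_inv₀, Complex.conj_ofReal]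
  have hUb' : ∀ b : Bond d (fineP L m), U b ∈ U1 𝔸 := fun b => by
    obtain ⟨y, κ⟩ := b
    have h := hU1 (liftSite y) κ
    rwa [B9Eq315QTorus.perCfg_apply, perSite_liftSite] at h
  have hUb : ∀ b : Bond d (fineP L m), ‖(U b : 𝔸)‖ ≤ 1 ∧ ‖(((U b)⁻¹ : 𝔸ˣ) : 𝔸)‖ ≤ 1 := fun b => B7Prop1Explicit.mem_U1.1 (hUb' b)
  have hpl : ∀ p : B9SectCLatticeCarrier.Plaq d (fineP L m), ‖(plaqHolU U p : 𝔸) - 1‖ ≤ 4 * ε := norm_plaqHolU_sub_one_le hUb' hUε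
  have hR : ∀ (b : Bond d (fineP L m)) (w : W), ‖adTransportW φ U b w - w‖ ≤ 1 * ‖w‖ := fun b w =>
    (norm_adTransportW_sub_le φ hφ hφ' hMφ' U b (hUb' b) (hUε b) w).trans (mul_le_mul_of_nonneg_right hεR1 (norm_nonneg _))
  have hd : Real.sqrt d * Real.sqrt d = d := Real.mul_self_sqrt (Nat.cast_nonneg d)
  -- the four pieces
  have hP : ‖principalOpK φ η U x‖ ≤ 64 * d * ‖((η : ℂ))⁻¹‖ ^ 2 * ‖x‖ := by
    rw [B9Eq310HessianOperator.principalOpK_eq_comp, LinearMap.comp_apply]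
    calc _ ≤ 4 * Real.sqrt d * ((1 + 1) * ‖((η : ℂ))⁻¹‖) * ‖B9Eq310HessianOperator.covCurlL2K ℂ c₀ ((η : ℂ))⁻¹ (adTransportW φ U) x‖ :=
          norm_covCoCurlL2K_le _ hc zero_le_one hR hRS _
      _ ≤ 4 * Real.sqrt d * ((1 + 1) * ‖((η : ℂ))⁻¹‖) * (4 * Real.sqrt d * ((1 + 1) * ‖((η : ℂ))⁻¹‖) * ‖x‖) :=
          mul_le_mul_of_nonneg_left (norm_covCurlL2K_le _ zero_le_one hR x) (by positivity)
      _ = 64 * (Real.sqrt d * Real.sqrt d) * ‖((η : ℂ))⁻¹‖ ^ 2 * ‖x‖ := by ring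
      _ = 64 * d * ‖((η : ℂ))⁻¹‖ ^ 2 * ‖x‖ := by rw [hd]
  have hC : ‖curvOp φ τ η U x‖ ≤ 32 * d * Cτ * Mφ ^ 2 * (|η| ^ d / c₀) * (‖((η : ℂ))⁻¹‖ ^ 2 * (4 * ε)) * ‖x‖ :=
    norm_curvOp_le φ hτ hCτ hφ η hUb hpl hMφ (by positivity) x
  have hDRD : ‖covDerivL2K ℂ c₀ ((η : ℂ))⁻¹ (adTransportW φ U) (RofU L m φ η U (covDivL2K ℂ c₀ ((η : ℂ))⁻¹ (adTransportW φ fun b => (U b)⁻¹) x))‖ ≤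
      16 * ‖((η : ℂ))⁻¹‖ ^ 2 * d * ‖x‖ := by
    have h1 := norm_covDerivL2K_le ((η : ℂ))⁻¹ zero_le_one hR (RofU L m φ η U (covDivL2K ℂ c₀ ((η : ℂ))⁻¹ (adTransportW φ fun b => (U b)⁻¹) x))
    have h2 : ‖RofU L m φ η U (covDivL2K ℂ c₀ ((η : ℂ))⁻¹ (adTransportW φ fun b => (U b)⁻¹) x)‖ ≤
        ‖covDivL2K ℂ c₀ ((η : ℂ))⁻¹ (adTransportW φ fun b => (U b)⁻¹) x‖ := by
      unfold RofU B11Eq103H1Complex.RLatticeK; exact norm_projR_le _ _ _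
    have h3 := norm_covDivL2K_le ((η : ℂ))⁻¹ hc zero_le_one hR hRS x
    calc _ ≤ 2 * (1 + 1) * ‖((η : ℂ))⁻¹‖ * Real.sqrt d * ‖RofU L m φ η U (covDivL2K ℂ c₀ ((η : ℂ))⁻¹ (adTransportW φ fun b => (U b)⁻¹) x)‖ := h1
      _ ≤ 2 * (1 + 1) * ‖((η : ℂ))⁻¹‖ * Real.sqrt d * (2 * (1 + 1) * ‖((η : ℂ))⁻¹‖ * Real.sqrt d * ‖x‖) :=
          mul_le_mul_of_nonneg_left (h2.trans h3) (by positivity)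
      _ = 16 * ‖((η : ℂ))⁻¹‖ ^ 2 * (Real.sqrt d * Real.sqrt d) * ‖x‖ := by ring
      _ = 16 * ‖((η : ℂ))⁻¹‖ ^ 2 * d * ‖x‖ := by rw [hd]
  have hQQ : ‖LinearMap.adjoint (QtorusW L m hL φ U hα1 hU1 hreg (c₀ := c₀) (c₁ := c₁)) ((RCLike.ofReal a : ℂ) • QtorusW L m hL φ U hα1 hU1 hreg (c₀ := c₀) (c₁ := c₁) x)‖ ≤
      MQU * (|a| * MQU) * ‖x‖ := by
    refine (norm_adjoint_apply_le _ hMQU hQU _).trans ?_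
    rw [norm_smul, RCLike.norm_ofReal]
    calc MQU * (|a| * ‖QtorusW L m hL φ U hα1 hU1 hreg (c₀ := c₀) (c₁ := c₁) x‖) ≤ MQU * (|a| * (MQU * ‖x‖)) := by gcongr; exact hQU x
      _ = MQU * (|a| * MQU) * ‖x‖ := by ring
  -- assembly: `Δ_a x = (D*D + Δ′)x + D(R(D*x)) + Q†(aQx)`
  have hsplit : laplaceAofBackground L m hL φ U hα1 hU1 hreg τ η (c₀ := c₀) (c₁ := c₁) a x =
      principalOpK φ η U x + curvOp φ τ η U x +
        covDerivL2K ℂ c₀ ((η : ℂ))⁻¹ (adTransportW φ U) (RofU L m φ η U (covDivL2K ℂ c₀ ((η : ℂ))⁻¹ (adTransportW φ fun b => (U b)⁻¹) x)) +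
        LinearMap.adjoint (QtorusW L m hL φ U hα1 hU1 hreg (c₀ := c₀) (c₁ := c₁)) ((RCLike.ofReal a : ℂ) • QtorusW L m hL φ U hα1 hU1 hreg (c₀ := c₀) (c₁ := c₁) x) := by
    show laplaceALatticeK ((η : ℂ))⁻¹ (adTransportW φ U) (adTransportW φ fun b => (U b)⁻¹) (hessOp φ η U τ) (RofU L m φ η U)
        (QtorusW L m hL φ U hα1 hU1 hreg (c₁ := c₁)) a x = _
    simp only [laplaceALatticeK, B11Eq103H1Complex.laplaceAK_apply, hessOp_apply]
  rw [hsplit]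
  calc _ ≤ ‖principalOpK φ η U x + curvOp φ τ η U x‖ +
        ‖covDerivL2K ℂ c₀ ((η : ℂ))⁻¹ (adTransportW φ U) (RofU L m φ η U (covDivL2K ℂ c₀ ((η : ℂ))⁻¹ (adTransportW φ fun b => (U b)⁻¹) x))‖ +
        ‖LinearMap.adjoint (QtorusW L m hL φ U hα1 hU1 hreg (c₀ := c₀) (c₁ := c₁)) ((RCLike.ofReal a : ℂ) • QtorusW L m hL φ U hα1 hU1 hreg (c₀ := c₀) (c₁ := c₁) x)‖ :=
        norm_add₃_le
    _ ≤ (64 * d * ‖((η : ℂ))⁻¹‖ ^ 2 * ‖x‖ + 32 * d * Cτ * Mφ ^ 2 * (|η| ^ d / c₀) * (‖((η : ℂ))⁻¹‖ ^ 2 * (4 * ε)) * ‖x‖) +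
        16 * ‖((η : ℂ))⁻¹‖ ^ 2 * d * ‖x‖ + MQU * (|a| * MQU) * ‖x‖ :=
        add_le_add (add_le_add ((norm_add_le _ _).trans (add_le_add hP hC)) hDRD) hQQ
    _ = _ := by ring
set_option maxHeartbeats 400000 in
/-- **`H₁(U)` AND `𝔊(U)` ARE BOUNDED UNIFORMLY OVER THE SMALL FIELDS OF A FIXED LATTICE** ([B9] (3.126) `HB = GQ*(QGQ*)⁻¹B`, (3.153) `𝔊 =
G𝔓*`, with Thm 3.4/(3.86)'s uniform control of `G`): there are `C_H, C_G, ε₅ > 0` (finite-lattice numbers) such that for EVERY background `U` of E162's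
data with `‖U(b) − 1‖ ≤ ε ≤ ε₅` and `hRS`, and ANY positivity witness `hpos` / surjectivity witness `hQ` (e.g. `B9Thm311SmallFieldClosed.
laplaceAofBackground_pos_of_small_field`, `B9Eq315QTorusOnto.QtorusW_surjective`), the chain's `H₁(U) = B11Eq103H1Complex.H1LatticeK hpos hQ` and
`𝔊(U) = frakGLatticeK hpos hQ` satisfy `‖H₁(U)b‖ ≤ C_H‖b‖`, `‖𝔊(U)x‖ ≤ C_G‖x‖`.  Inputs: the uniform coercivity `γ₁` of `Δ_a(U)`
(`B9Thm311SmallFieldGreen`), the uniform operator bound of `Δ_a(U)` (`norm_laplaceAofBackground_le`), the flat modulus of `Q(1)†` (§2, `Q(1)` onto)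
perturbed by NE9 leaf-04's `δ_Q` (`B9Eq315QLipschitz`), §1.  NOT the chart's Banach norms (`NegSize`/`Space115`) — `L²` operator bounds only.
[cite: Balaban1985BackgroundPropagators, (3.126) p.420, (3.153) p.426, Thm 3.4 p.400, Thm 3.11 p.416; Balaban1985Variational, (45) p.285, (110)–(111) p.294] -/
theorem exists_H1_frakG_bound_of_small_field {η : ℝ} (hη : η ≠ 0) {a : ℝ} (ha : 0 < a) {Mφ Mφ' : ℝ} (hMφ : 0 ≤ Mφ) (hMφ' : 0 ≤ Mφ')
    (hφ : ∀ w, ‖φ w‖ ≤ Mφ * ‖w‖) (hφ' : ∀ X, ‖φ.symm X‖ ≤ Mφ' * ‖X‖) (τ : 𝔸 →ₗ[ℂ] ℂ) {Cτ : ℝ} (hτ : ∀ X, ‖τ X‖ ≤ Cτ * ‖X‖) (hCτ : 0 ≤ Cτ) :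
    ∃ CH CG ε₅ : ℝ, 0 < CH ∧ 0 < CG ∧ 0 < ε₅ ∧ ∀ (U : Bond d (fineP L m) → 𝔸ˣ) {α : ℝ} (hα1 : α ≤ 1 / 64)
      (hU1 : ∀ (x : B7Prop1Explicit.Site d) (κ : Fin d), perCfg (fineP L m) U x κ ∈ U1 𝔸)
      (hreg : ∀ (y : TSite d m) (κ : Fin d) (r : Fin d → Fin L), ‖((Wcx L (perCfg (fineP L m) U) (cornerSite L y) κ (boxVec L r) : 𝔸ˣ) : 𝔸) - 1‖ ≤ α)
      {ε : ℝ}, 0 ≤ ε → ε ≤ ε₅ → (∀ b, ‖(U b : 𝔸) - 1‖ ≤ ε) →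
      (∀ (b : Bond d (fineP L m)) (v u : W), ⟪adTransportW φ U b v, u⟫_ℂ = ⟪v, adTransportW φ (fun b => (U b)⁻¹) b u⟫_ℂ) →
      ∀ (hpos : ∀ x : BondL2K ℂ d (fineP L m) c₀ W, x ≠ 0 →
          0 < RCLike.re ⟪x, laplaceAofBackground L m hL φ U hα1 hU1 hreg τ η (c₀ := c₀) (c₁ := c₁) a x⟫_ℂ)
        (hQ : Function.Surjective (QtorusW L m hL φ U hα1 hU1 hreg (c₀ := c₀) (c₁ := c₁))),
      (∀ b : BondL2K ℂ d m c₁ W, ‖H1LatticeK hpos hQ b‖ ≤ CH * ‖b‖) ∧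
      (∀ x : BondL2K ℂ d (fineP L m) c₀ W, ‖frakGLatticeK hpos hQ x‖ ≤ CG * ‖x‖) := by
  have hc₀ : 0 < c₀ := Fact.out
  have hc : conj ((η : ℂ))⁻¹ = ((η : ℂ))⁻¹ := by rw [map_inv₀, Complex.conj_ofReal]
  -- the uniform coercivity of `Δ_a(U)`
  obtain ⟨γ₁, ε₃, hγ₁, hε₃, Hc⟩ := exists_coercive_laplaceA_of_small_field L m hL φ (c₀ := c₀) (c₁ := c₁) hη ha hMφ hMφ' hφ hφ' τ hτ hCτ
  -- the flat averaging: operator norm `MQ1` and the modulus `μQ1` of `Q(1)†`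
  obtain ⟨MQ1, hMQ1def⟩ : ∃ MQ1 : ℝ, MQ1 = ‖LinearMap.toContinuousLinearMap
    (QtorusW L m hL φ (fun _ => 1) (show (0 : ℝ) ≤ 1 / 64 by norm_num) (hU1_one L m) (hreg_one L m) (c₀ := c₀) (c₁ := c₁))‖ := ⟨_, rfl⟩
  have hMQ1 : 0 ≤ MQ1 := by
    rw [hMQ1def]
    exact norm_nonneg (LinearMap.toContinuousLinearMap
      (QtorusW L m hL φ (fun _ => 1) (show (0 : ℝ) ≤ 1 / 64 by norm_num) (hU1_one L m) (hreg_one L m) (c₀ := c₀) (c₁ := c₁)))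
  have hQ1 : ∀ x : BondL2K ℂ d (fineP L m) c₀ W,
      ‖QtorusW L m hL φ (fun _ => 1) (show (0 : ℝ) ≤ 1 / 64 by norm_num) (hU1_one L m) (hreg_one L m) (c₀ := c₀) (c₁ := c₁) x‖ ≤ MQ1 * ‖x‖ :=
    fun x => by
      rw [hMQ1def]
      exact (LinearMap.toContinuousLinearMap
        (QtorusW L m hL φ (fun _ => 1) (show (0 : ℝ) ≤ 1 / 64 by norm_num) (hU1_one L m) (hreg_one L m) (c₀ := c₀) (c₁ := c₁))).le_opNorm x
  have hαL0 : 50 * (d + 1) * (0 : ℝ) * (L : ℝ) ^ d ≤ 1 / 2 := by norm_num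
  obtain ⟨μQ1, hμQ1, hQ1adj⟩ := exists_modulus_of_injective
    (LinearMap.adjoint (QtorusW L m hL φ (fun _ => 1) (show (0 : ℝ) ≤ 1 / 64 by norm_num) (hU1_one L m) (hreg_one L m) (c₀ := c₀) (c₁ := c₁)))
    (adjoint_injective_of_surjective _ (QtorusW_surjective L m hL (fun _ => 1) (show (0 : ℝ) ≤ 1 / 64 by norm_num) (hU1_one L m) (hreg_one L m) hαL0 φ))
  -- the constants
  obtain ⟨KR, hKRdef⟩ : ∃ KR : ℝ, KR = 2 * Mφ * Mφ' := ⟨_, rfl⟩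
  have hKR : 0 ≤ KR := by rw [hKRdef]; positivity
  obtain ⟨CQ, hCQdef⟩ : ∃ CQ : ℝ, CQ = Mφ' * Mφ * Real.sqrt (c₁ * Fintype.card (Bond d m) / c₀) * (102 * (d + 1) ^ 2 * L) := ⟨_, rfl⟩
  have hCQ : 0 ≤ CQ := by rw [hCQdef]; positivity
  obtain ⟨MT, hMTdef⟩ : ∃ MT : ℝ, MT = 64 * d * ‖((η : ℂ))⁻¹‖ ^ 2 + 16 * ‖((η : ℂ))⁻¹‖ ^ 2 * d +
      32 * d * Cτ * Mφ ^ 2 * (|η| ^ d / c₀) * (‖((η : ℂ))⁻¹‖ ^ 2 * (4 * 1)) + (MQ1 + CQ) * (|a| * (MQ1 + CQ)) + 1 := ⟨_, rfl⟩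
  have hMT0 : 0 < MT := by rw [hMTdef]; positivity
  obtain ⟨MD, hMDdef⟩ : ∃ MD : ℝ, MD = 2 * (1 + 1) * ‖((η : ℂ))⁻¹‖ * Real.sqrt d := ⟨_, rfl⟩
  have hMD : 0 ≤ MD := by rw [hMDdef]; positivity
  refine ⟨γ₁⁻¹ * (MQ1 + CQ) * (γ₁ * (μQ1 / 2) ^ 2 / MT ^ 2)⁻¹ + 1,
    γ₁⁻¹ * (1 + (MQ1 + CQ) * (γ₁ * (μQ1 / 2) ^ 2 / MT ^ 2)⁻¹ * (MQ1 + CQ) * γ₁⁻¹ + MD * MD * γ₁⁻¹) + 1,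
    min ε₃ (min (1 / (KR + 1)) (min 1 (μQ1 / (2 * CQ + 1)))), by positivity, by positivity, by positivity, ?_⟩
  intro U α hα1 hU1 hreg ε hε hε₅ hUε hRS hpos hQs
  have hεε₃ : ε ≤ ε₃ := hε₅.trans (min_le_left _ _)
  have hε1' : ε ≤ 1 / (KR + 1) := hε₅.trans ((min_le_right _ _).trans (min_le_left _ _))
  have hε1 : ε ≤ 1 := hε₅.trans ((min_le_right _ _).trans ((min_le_right _ _).trans (min_le_left _ _)))
  have hεμ : ε ≤ μQ1 / (2 * CQ + 1) := hε₅.trans ((min_le_right _ _).trans ((min_le_right _ _).trans (min_le_right _ _)))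
  have hεR1 : 2 * Mφ * Mφ' * ε ≤ 1 := by
    rw [← hKRdef]
    refine (mul_le_mul_of_nonneg_left hε1' hKR).trans ?_
    rw [mul_one_div, div_le_one (by positivity)]; linarith
  have hδQ : CQ * ε ≤ μQ1 / 2 := by
    have h1 : CQ * ε ≤ CQ * (μQ1 / (2 * CQ + 1)) := mul_le_mul_of_nonneg_left hεμ hCQ
    have h2 : CQ * (μQ1 / (2 * CQ + 1)) ≤ μQ1 / 2 := by
      rw [mul_div_assoc', div_le_div_iff₀ (by positivity) (by norm_num)]; nlinarith
    exact h1.trans h2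
  -- `Q(U)`: operator bound and modulus of its adjoint
  have hQdiff : ∀ x : BondL2K ℂ d (fineP L m) c₀ W, ‖QtorusW L m hL φ U hα1 hU1 hreg (c₁ := c₁) x -
      QtorusW L m hL φ (fun _ => 1) (show (0 : ℝ) ≤ 1 / 64 by norm_num) (hU1_one L m) (hreg_one L m) (c₁ := c₁) x‖ ≤ CQ * ε * ‖x‖ := fun x => by
    refine (norm_QtorusW_sub_flat_le L m hL U hα1 hU1 hreg (show (0 : ℝ) ≤ 1 / 64 by norm_num) (hU1_one L m) (hreg_one L m) hε hUε φ
      hMφ hφ hMφ' hφ' x).trans (le_of_eq ?_)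
    rw [hCQdef]; ring
  have hQU : ∀ x : BondL2K ℂ d (fineP L m) c₀ W, ‖QtorusW L m hL φ U hα1 hU1 hreg (c₀ := c₀) (c₁ := c₁) x‖ ≤ (MQ1 + CQ) * ‖x‖ := fun x => by
    have h1 := hQ1 x
    have h2 := hQdiff x
    have h3 := norm_le_insert' (QtorusW L m hL φ U hα1 hU1 hreg (c₀ := c₀) (c₁ := c₁) x)
      (QtorusW L m hL φ (fun _ => 1) (show (0 : ℝ) ≤ 1 / 64 by norm_num) (hU1_one L m) (hreg_one L m) (c₀ := c₀) (c₁ := c₁) x)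
    have h4 : CQ * ε * ‖x‖ ≤ CQ * ‖x‖ := mul_le_mul_of_nonneg_right (mul_le_of_le_one_right hCQ hε1) (norm_nonneg x)
    linarith
  have hQUadj : ∀ y : BondL2K ℂ d m c₁ W, μQ1 / 2 * ‖y‖ ≤ ‖LinearMap.adjoint (QtorusW L m hL φ U hα1 hU1 hreg (c₀ := c₀) (c₁ := c₁)) y‖ := fun y => by
    have h1 := hQ1adj y
    have h2 : ‖LinearMap.adjoint (QtorusW L m hL φ U hα1 hU1 hreg (c₀ := c₀) (c₁ := c₁) -
        QtorusW L m hL φ (fun _ => 1) (show (0 : ℝ) ≤ 1 / 64 by norm_num) (hU1_one L m) (hreg_one L m) (c₀ := c₀) (c₁ := c₁)) y‖ ≤ CQ * ε * ‖y‖ :=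
      norm_adjoint_apply_le _ (by positivity) (fun x => by rw [LinearMap.sub_apply]; exact hQdiff x) y
    rw [map_sub, LinearMap.sub_apply] at h2
    have h3 := norm_le_insert (LinearMap.adjoint (QtorusW L m hL φ U hα1 hU1 hreg (c₀ := c₀) (c₁ := c₁)) y)
      (LinearMap.adjoint (QtorusW L m hL φ (fun _ => 1) (show (0 : ℝ) ≤ 1 / 64 by norm_num) (hU1_one L m) (hreg_one L m) (c₀ := c₀) (c₁ := c₁)) y)
    have h4 : CQ * ε * ‖y‖ ≤ μQ1 / 2 * ‖y‖ := mul_le_mul_of_nonneg_right hδQ (norm_nonneg _)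
    linarith
  -- the operator bound of `Δ_a(U)` and its letters in the `laplaceAK` form
  have hMTU := norm_laplaceAofBackground_le L m hL φ hMφ hMφ' hφ hφ' τ hτ hCτ (η := η) a U hα1 hU1 hreg hε hεR1 hUε hRS (by positivity) hQU
  have hMT : ∀ x : BondL2K ℂ d (fineP L m) c₀ W,
      ‖B11Eq103H1Complex.laplaceAK (hessOp φ η U τ) (covDerivL2K ℂ c₀ ((η : ℂ))⁻¹ (adTransportW φ U)) (RofU L m φ η U)
        (covDivL2K ℂ c₀ ((η : ℂ))⁻¹ (adTransportW φ fun b => (U b)⁻¹)) (QtorusW L m hL φ U hα1 hU1 hreg (c₀ := c₀) (c₁ := c₁))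
        (LinearMap.adjoint (QtorusW L m hL φ U hα1 hU1 hreg (c₀ := c₀) (c₁ := c₁))) (RCLike.ofReal a) x‖ ≤ MT * ‖x‖ := fun x => by
    refine (hMTU x).trans (mul_le_mul_of_nonneg_right ?_ (norm_nonneg _))
    rw [hMTdef]
    have h1 : 32 * d * Cτ * Mφ ^ 2 * (|η| ^ d / c₀) * (‖((η : ℂ))⁻¹‖ ^ 2 * (4 * ε)) ≤
        32 * d * Cτ * Mφ ^ 2 * (|η| ^ d / c₀) * (‖((η : ℂ))⁻¹‖ ^ 2 * (4 * 1)) := by gcongr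
    linarith
  have hcoer : ∀ x : BondL2K ℂ d (fineP L m) c₀ W, γ₁ * ‖x‖ ^ 2 ≤ RCLike.re ⟪x,
      B11Eq103H1Complex.laplaceAK (hessOp φ η U τ) (covDerivL2K ℂ c₀ ((η : ℂ))⁻¹ (adTransportW φ U)) (RofU L m φ η U)
        (covDivL2K ℂ c₀ ((η : ℂ))⁻¹ (adTransportW φ fun b => (U b)⁻¹)) (QtorusW L m hL φ U hα1 hU1 hreg (c₀ := c₀) (c₁ := c₁))
        (LinearMap.adjoint (QtorusW L m hL φ U hα1 hU1 hreg (c₀ := c₀) (c₁ := c₁))) (RCLike.ofReal a) x⟫_ℂ :=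
    fun x => Hc U hα1 hU1 hreg hε hεε₃ hUε hRS x
  have hpos' : ∀ x : BondL2K ℂ d (fineP L m) c₀ W, x ≠ 0 → 0 < RCLike.re ⟪x,
      B11Eq103H1Complex.laplaceAK (hessOp φ η U τ) (covDerivL2K ℂ c₀ ((η : ℂ))⁻¹ (adTransportW φ U)) (RofU L m φ η U)
        (covDivL2K ℂ c₀ ((η : ℂ))⁻¹ (adTransportW φ fun b => (U b)⁻¹)) (QtorusW L m hL φ U hα1 hU1 hreg (c₀ := c₀) (c₁ := c₁))
        (LinearMap.adjoint (QtorusW L m hL φ U hα1 hU1 hreg (c₀ := c₀) (c₁ := c₁))) (RCLike.ofReal a) x⟫_ℂ := hpos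
  have hμ2 : 0 < μQ1 / 2 := by positivity
  have hD : ∀ s : SiteL2K ℂ d (fineP L m) c₀ W, ‖covDerivL2K ℂ c₀ ((η : ℂ))⁻¹ (adTransportW φ U) s‖ ≤ MD * ‖s‖ := fun s => by
    rw [hMDdef]
    have hUb' : ∀ b : Bond d (fineP L m), U b ∈ U1 𝔸 := fun b => by
      obtain ⟨y, κ⟩ := b
      have h := hU1 (liftSite y) κ
      rwa [B9Eq315QTorus.perCfg_apply, perSite_liftSite] at h
    exact norm_covDerivL2K_le _ zero_le_one (fun b w => (norm_adTransportW_sub_le φ hφ hφ' hMφ' U b (hUb' b) (hUε b) w).trans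
      (mul_le_mul_of_nonneg_right hεR1 (norm_nonneg _))) s
  have hDs : ∀ x : BondL2K ℂ d (fineP L m) c₀ W, ‖covDivL2K ℂ c₀ ((η : ℂ))⁻¹ (adTransportW φ fun b => (U b)⁻¹) x‖ ≤ MD * ‖x‖ := fun x => by
    rw [hMDdef]
    have hUb' : ∀ b : Bond d (fineP L m), U b ∈ U1 𝔸 := fun b => by
      obtain ⟨y, κ⟩ := b
      have h := hU1 (liftSite y) κ
      rwa [B9Eq315QTorus.perCfg_apply, perSite_liftSite] at h
    exact norm_covDivL2K_le _ hc zero_le_one (fun b w => (norm_adTransportW_sub_le φ hφ hφ' hMφ' U b (hUb' b) (hUε b) w).trans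
      (mul_le_mul_of_nonneg_right hεR1 (norm_nonneg _))) hRS x
  have hRle : ∀ s : SiteL2K ℂ d (fineP L m) c₀ W, ‖RofU L m φ η U s‖ ≤ ‖s‖ := fun s => by
    unfold RofU B11Eq103H1Complex.RLatticeK; exact norm_projR_le _ _ s
  refine ⟨fun b => ?_, fun x => ?_⟩
  · have h := norm_H1K_le (𝕜 := ℂ) (E := BondL2K ℂ d (fineP L m) c₀ W) (F := BondL2K ℂ d m c₁ W) (S := SiteL2K ℂ d (fineP L m) c₀ W)
      (Δ := hessOp φ η U τ (c₀ := c₀)) (D := covDerivL2K ℂ c₀ ((η : ℂ))⁻¹ (adTransportW φ U)) (R := RofU L m φ η U (c₀ := c₀))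
      (Dstar := covDivL2K ℂ c₀ ((η : ℂ))⁻¹ (adTransportW φ fun b => (U b)⁻¹)) (Q := QtorusW L m hL φ U hα1 hU1 hreg (c₀ := c₀) (c₁ := c₁))
      (a := RCLike.ofReal a) (γ := γ₁) (MT := MT) (MQ := MQ1 + CQ) (μQ := μQ1 / 2) hγ₁ hcoer hMT hpos' (by positivity) hμ2 hQU hQUadj
      (fun x' y' => (LinearMap.adjoint_inner_right _ x' y').symm) (adjoint_injective_of_modulus hμ2 hQUadj) hMT0 b
    have h' : ‖H1LatticeK hpos hQs b‖ ≤ γ₁⁻¹ * (MQ1 + CQ) * (γ₁ * (μQ1 / 2) ^ 2 / MT ^ 2)⁻¹ * ‖b‖ := h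
    exact h'.trans (mul_le_mul_of_nonneg_right (le_add_of_nonneg_right zero_le_one) (norm_nonneg b))
  · have h := norm_frakGLin_le (𝕜 := ℂ) (E := BondL2K ℂ d (fineP L m) c₀ W) (F := BondL2K ℂ d m c₁ W) (S := SiteL2K ℂ d (fineP L m) c₀ W)
      (Δ := hessOp φ η U τ (c₀ := c₀)) (D := covDerivL2K ℂ c₀ ((η : ℂ))⁻¹ (adTransportW φ U)) (R := RofU L m φ η U (c₀ := c₀))
      (Dstar := covDivL2K ℂ c₀ ((η : ℂ))⁻¹ (adTransportW φ fun b => (U b)⁻¹)) (Q := QtorusW L m hL φ U hα1 hU1 hreg (c₀ := c₀) (c₁ := c₁))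
      (a := RCLike.ofReal a) (γ := γ₁) (MT := MT) (MQ := MQ1 + CQ) (μQ := μQ1 / 2) (MD := MD) hγ₁ hcoer hMT hpos' (by positivity) hμ2 hQU hQUadj
      (fun x' y' => (LinearMap.adjoint_inner_right _ x' y').symm) (adjoint_injective_of_modulus hμ2 hQUadj) hMD hD hDs hRle hMT0 x
    have h' : ‖frakGLatticeK hpos hQs x‖ ≤ γ₁⁻¹ * (1 + (MQ1 + CQ) * (γ₁ * (μQ1 / 2) ^ 2 / MT ^ 2)⁻¹ * (MQ1 + CQ) * γ₁⁻¹ + MD * MD * γ₁⁻¹) * ‖x‖ := h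
    exact h'.trans (mul_le_mul_of_nonneg_right (le_add_of_nonneg_right zero_le_one) (norm_nonneg x))

end SmallField


end Literature.MathematicalPhysics.QuantumFieldTheory.Balaban1983to89.B9Eq3126H1Bound

end
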